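import Summits.QuantumAdvantage.QuantumAdvantage.Theorems.WalkTwoStepSparsePinnedFibre

/-!
# (G♯) local engine — toward `FarLocal p`, part 1: the second involution and the FOUR-POINT PARITY formula

Cell qa-qnc0, rung (G♯) = item stmt-QuantumAdvantage-23121 `OddPrimeWalk.TwoStepFreeRungFive` (planner qa-qnc0-p2 g24, ask P2-24b,
ROUND-24 §1ter REVISION (h)); prover qn-prover-3 g15.  `FarLocal` is the one genuinely new regime lemma of the checked skeleton
`WalkTwoStepLocalEngine{Core,Regimes,Glue}.lean`: at the position `τ₁ = g` of a FAR cut (`α_g ≠ β_g`, split `τ₂ = s_g` at distance `≥ d₀`,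
`p ≤ s_g ≤ n − p`) a constant fraction of every weight class is DISCORDANT under the corner flip `φ = cornerFlip n g`.

This file is the combinatorial core, with no counting: for the discordance bit `f u := win u ⊕ win (φ u)` and the SECOND involution
`ψ = cornerFlip n s_g` (the corner flip at the far split), the **four-point parity formula**
`f u ⊕ f (ψ u) = [fire_g u ≠ fire_g (ψ u)]·[live_g u ≠ live_g (φ u)] ⊕ [s_{h₂} = g]·[fire_{h₂} u ≠ fire_{h₂} (φ u)]·[live_{h₂} u ≠ live_{h₂} (ψ u)]`
(`fourPoint_formula`), where `h₂` is the cut sitting at position `s_g` (the only possible "mirror" co-observer).  Ingredients: `φ` and `ψ`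
commute (`cornerFlip_comm`, distance `≥ 2`); a cut observes the flip at `τ` only through its position or its split
(`status_cornerFlip_of_ne`, from the landed `y_cornerFlip` / `walkExp_cornerFlip`); so over the four inputs `u, φu, ψu, φψu` every cut
other than `g` and `h₂` has an EVEN number of live firings, while `g` and `h₂` contribute products `(F + F')(L + L')`
(`odd_fourStatus_iff`).  Consequence used downstream: whenever the right-hand side is `true`, `u` and `ψ u` have different discordance
bits, so `card_discordant_le_two_mul_card_true` (landed, `WalkTwoStepLocalEngineCore`) turns a count of such `u` into a count of
discordant inputs.  WHAT THIS IS NOT: no counting, no `FarLocal` yet; separation NOT moved.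
-/

namespace Summit.QuantumAdvantage.AdviceFreeQNC0.LocalEngine

open Finset Classical

section FourPoint

variable {p n : ℕ}

/-! ### Corner flips at distance `≥ 2` commute -/

/-- Two corner flips whose positions differ by at least `2` commute (disjoint transpositions). -/
theorem cornerFlip_comm {τ₁ τ₂ : ℕ} (hτ : τ₁ + 2 ≤ τ₂ ∨ τ₂ + 2 ≤ τ₁) (u : Fin n → Bool) :
    cornerFlip n τ₁ (cornerFlip n τ₂ u) = cornerFlip n τ₂ (cornerFlip n τ₁ u) := by
  unfold cornerFlip
  by_cases h₁ : 1 ≤ τ₁ ∧ τ₁ < n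
  · by_cases h₂ : 1 ≤ τ₂ ∧ τ₂ < n
    · simp only [dif_pos h₁, dif_pos h₂]
      funext i
      simp only [Function.comp_apply]
      congr 1
      -- the two transpositions have disjoint supports
      set a₁ : Fin n := ⟨τ₁ - 1, by omega⟩
      set b₁ : Fin n := ⟨τ₁, h₁.2⟩
      set a₂ : Fin n := ⟨τ₂ - 1, by omega⟩
      set b₂ : Fin n := ⟨τ₂, h₂.2⟩
      have ha₁ : a₁ ≠ a₂ ∧ a₁ ≠ b₂ := ⟨fun h => by have := congrArg Fin.val h; simp [a₁, a₂] at this; omega,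
        fun h => by have := congrArg Fin.val h; simp [a₁, b₂] at this; omega⟩
      have hb₁ : b₁ ≠ a₂ ∧ b₁ ≠ b₂ := ⟨fun h => by have := congrArg Fin.val h; simp [b₁, a₂] at this; omega,
        fun h => by have := congrArg Fin.val h; simp [b₁, b₂] at this; omega⟩
      by_cases hi₁ : i = a₁ ∨ i = b₁
      · -- `i` in the support of the first swap: the second swap fixes `i` and its image
        have hfix : Equiv.swap a₂ b₂ i = i := by
          rcases hi₁ with rfl | rfl
          · exact Equiv.swap_apply_of_ne_of_ne ha₁.1 ha₁.2
          · exact Equiv.swap_apply_of_ne_of_ne hb₁.1 hb₁.2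
        have hfix' : Equiv.swap a₂ b₂ (Equiv.swap a₁ b₁ i) = Equiv.swap a₁ b₁ i := by
          rcases hi₁ with rfl | rfl
          · rw [Equiv.swap_apply_left]; exact Equiv.swap_apply_of_ne_of_ne hb₁.1 hb₁.2
          · rw [Equiv.swap_apply_right]; exact Equiv.swap_apply_of_ne_of_ne ha₁.1 ha₁.2
        rw [hfix, hfix']
      · push Not at hi₁
        have hfix : Equiv.swap a₁ b₁ i = i := Equiv.swap_apply_of_ne_of_ne hi₁.1 hi₁.2
        rw [hfix]
        by_cases hi₂ : i = a₂ ∨ i = b₂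
        · rcases hi₂ with rfl | rfl
          · rw [Equiv.swap_apply_left]; exact (Equiv.swap_apply_of_ne_of_ne ha₁.2.symm hb₁.2.symm).symm
          · rw [Equiv.swap_apply_right]; exact (Equiv.swap_apply_of_ne_of_ne ha₁.1.symm hb₁.1.symm).symm
        · push Not at hi₂
          rw [Equiv.swap_apply_of_ne_of_ne hi₂.1 hi₂.2, hfix]
    · simp only [dif_pos h₁, dif_neg h₂]
  · simp only [dif_neg h₁]

/-! ### A cut observes the flip at `τ` only through its position or its split -/

/-- The status of a cut whose position and split both differ from `τ` is invariant under the corner flip at `τ`. -/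
theorem status_cornerFlip_of_ne (c : ℕ) (S : TwoStep p n) (h : Fin (n + 1)) (τ : ℕ) (u : Fin n → Bool)
    (h1 : h.val ≠ τ) (h2 : S.s h ≠ τ) : status c S h (cornerFlip n τ u) = status c S h u := by
  unfold status
  rw [y_cornerFlip S τ u h h2, walkExp_cornerFlip τ u h1]

/-- The fire bit of a cut whose split differs from `τ` is invariant under the corner flip at `τ`. -/
theorem y_cornerFlip_of_ne (S : TwoStep p n) (h : Fin (n + 1)) (τ : ℕ) (u : Fin n → Bool) (h2 : S.s h ≠ τ) :
    S.y h (cornerFlip n τ u) = S.y h u :=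
  y_cornerFlip S τ u h h2

/-- The live bit of position `h` is invariant under the corner flip at `τ ≠ h`. -/
theorem live_cornerFlip_of_ne (c : ℕ) (h : Fin (n + 1)) (τ : ℕ) (u : Fin n → Bool) (h1 : h.val ≠ τ) :
    decide ((c + h.val + walkExp (cornerFlip n τ u) h.val) % 3 ≠ 0) = decide ((c + h.val + walkExp u h.val) % 3 ≠ 0) := by
  rw [walkExp_cornerFlip τ u h1]

/-! ### Parity bookkeeping -/

/-- `Bool`s as summands. -/
theorem toNat_eq_ite (b : Bool) : b.toNat = if b = true then 1 else 0 := by cases b <;> rfl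

/-- The xor of two bits with prescribed parities is the parity of the sum. -/
theorem xor_eq_true_iff_odd_add {a b : Bool} {A B : ℕ} (ha : a = true ↔ Odd A) (hb : b = true ↔ Odd B) :
    (xor a b) = true ↔ Odd (A + B) := by
  have h1 : (xor a b = true) ↔ ((a = true) ↔ ¬ (b = true)) := by cases a <;> cases b <;> decide
  rw [h1, ha, hb, Nat.odd_add, Nat.not_odd_iff_even]

/-- **Four statuses of product form have odd sum iff both factors flip.** -/
theorem odd_fourStatus_iff (F F' L L' : Bool) :
    Odd ((F && L).toNat + (F && L').toNat + (F' && L).toNat + (F' && L').toNat) ↔ (F ≠ F' ∧ L ≠ L') := by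
  cases F <;> cases F' <;> cases L <;> cases L' <;> decide

/-- Two equal pairs of statuses have even sum. -/
theorem even_twoPairs (a b : Bool) : Even (a.toNat + a.toNat + (b.toNat + b.toNat)) := by
  cases a <;> cases b <;> decide

/-- `ringWinU` is the parity of the number of cuts with `status = true`, written as a sum of bits. -/
theorem ringWinU_eq_true_iff_odd_sum (c : ℕ) (S : TwoStep p n) (u : Fin n → Bool) :
    ringWinU c S.y u = true ↔ Odd (∑ h : Fin (n + 1), (status c S h u).toNat) := by
  rw [ringWinU_eq_true_iff_odd_status, Finset.card_filter]
  simp only [toNat_eq_ite]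

/-! ### The four-point formula -/

/-- The discordance bit of `u` under the flip `φ`: `win u ⊕ win (φ u)`. -/
def discBit (c : ℕ) (S : TwoStep p n) (τ : ℕ) (u : Fin n → Bool) : Bool :=
  xor (ringWinU c S.y u) (ringWinU c S.y (cornerFlip n τ u))

/-- `discBit = true` is exactly the discordance predicate of `FarLocal`. -/
theorem discBit_eq_true_iff (c : ℕ) (S : TwoStep p n) (τ : ℕ) (u : Fin n → Bool) :
    discBit c S τ u = true ↔ ringWinU c S.y u ≠ ringWinU c S.y (cornerFlip n τ u) := by
  unfold discBit
  cases ringWinU c S.y u <;> cases ringWinU c S.y (cornerFlip n τ u) <;> simp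

/-- Generic parity reduction: if all summands except at `g` and `h₂` are even, the parity of the sum is that of `t g + t h₂`. -/
theorem odd_sum_iff_of_even_off {m : ℕ} (t : Fin m → ℕ) (g h₂ : Fin m) (hgh : g ≠ h₂)
    (heven : ∀ h, h ≠ g → h ≠ h₂ → Even (t h)) :
    Odd (∑ h : Fin m, t h) ↔ Odd (t g + t h₂) := by
  have e1 := Finset.add_sum_erase (univ : Finset (Fin m)) t (Finset.mem_univ g)
  have hh₂ : h₂ ∈ (univ : Finset (Fin m)).erase g := Finset.mem_erase.mpr ⟨hgh.symm, Finset.mem_univ _⟩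
  have e2 := Finset.add_sum_erase _ t hh₂
  have hrest : Even (∑ h ∈ ((univ : Finset (Fin m)).erase g).erase h₂, t h) := by
    apply Finset.even_sum
    intro h hh
    rw [Finset.mem_erase, Finset.mem_erase] at hh
    exact heven h hh.2.1 hh.1
  rw [← e1, ← e2, ← add_assoc, Nat.odd_add]
  constructor
  · intro h; exact h.mpr hrest
  · intro h; exact ⟨fun _ => hrest, fun _ => h⟩

/-- The four-input count of live firings of the cut `h`, for the flips `φ = cornerFlip n τ₁`, `ψ = cornerFlip n τ₂`. -/
def fourCount (c : ℕ) (S : TwoStep p n) (τ₁ τ₂ : ℕ) (u : Fin n → Bool) (h : Fin (n + 1)) : ℕ :=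
  (status c S h u).toNat + (status c S h (cornerFlip n τ₁ u)).toNat
    + ((status c S h (cornerFlip n τ₂ u)).toNat + (status c S h (cornerFlip n τ₁ (cornerFlip n τ₂ u))).toNat)

/-- Step 1: the xor of the two discordance bits is the parity of `Σ_h fourCount h`. -/
theorem xor_discBit_iff_odd_sum (c : ℕ) (S : TwoStep p n) (τ₁ τ₂ : ℕ) (u : Fin n → Bool) :
    (xor (discBit c S τ₁ u) (discBit c S τ₁ (cornerFlip n τ₂ u)) = true) ↔
      Odd (∑ h : Fin (n + 1), fourCount c S τ₁ τ₂ u h) := by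
  have e : ∑ h : Fin (n + 1), fourCount c S τ₁ τ₂ u h
      = (∑ h : Fin (n + 1), (status c S h u).toNat + ∑ h : Fin (n + 1), (status c S h (cornerFlip n τ₁ u)).toNat)
        + (∑ h : Fin (n + 1), (status c S h (cornerFlip n τ₂ u)).toNat
          + ∑ h : Fin (n + 1), (status c S h (cornerFlip n τ₁ (cornerFlip n τ₂ u))).toNat) := by
    unfold fourCount
    rw [Finset.sum_add_distrib, Finset.sum_add_distrib, Finset.sum_add_distrib]
  rw [e]
  unfold discBit
  exact xor_eq_true_iff_odd_add
    (xor_eq_true_iff_odd_add (ringWinU_eq_true_iff_odd_sum c S u) (ringWinU_eq_true_iff_odd_sum c S _))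
    (xor_eq_true_iff_odd_add (ringWinU_eq_true_iff_odd_sum c S _) (ringWinU_eq_true_iff_odd_sum c S _))

/-- Step 2: a cut other than `g` (the flipped position) and `h₂` (the cut at the split `s_g`) has an even four-count. -/
theorem even_fourCount_of_ne (c : ℕ) (S : TwoStep p n) (g h₂ : Fin (n + 1))
    (hdist : g.val + 2 ≤ h₂.val ∨ h₂.val + 2 ≤ g.val) (u : Fin n → Bool) (h : Fin (n + 1)) (hg : h ≠ g) (hh : h ≠ h₂) :
    Even (fourCount c S g.val h₂.val u h) := by
  have hgval : g.val ≠ h₂.val := by intro e; rcases hdist with h | h <;> omega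
  have hval_g : h.val ≠ g.val := fun e => hg (Fin.ext e)
  have hval_h : h.val ≠ h₂.val := fun e => hh (Fin.ext e)
  unfold fourCount
  by_cases hs : S.s h = g.val
  · -- co-observer of the flip at `g`, not sitting at `s_g`: invariant under `ψ`
    have hs2 : S.s h ≠ h₂.val := by rw [hs]; exact hgval
    rw [status_cornerFlip_of_ne c S h _ u hval_h hs2, cornerFlip_comm hdist u,
      status_cornerFlip_of_ne c S h _ _ hval_h hs2]
    have := even_twoPairs (status c S h u) (status c S h (cornerFlip n g.val u))
    obtain ⟨k, hk⟩ := this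
    exact ⟨k, by omega⟩
  · -- does not observe the flip at `g`: invariant under `φ`
    rw [status_cornerFlip_of_ne c S h _ u hval_g hs, status_cornerFlip_of_ne c S h _ _ hval_g hs]
    exact even_twoPairs (status c S h u) (status c S h (cornerFlip n h₂.val u))

/-- Step 3: the flipped cut `g` has a four-count of product form `(F + F')(L + L')`. -/
theorem odd_fourCount_self_iff (c : ℕ) (S : TwoStep p n) (g h₂ : Fin (n + 1)) (hsplit : S.s g = h₂.val)
    (hdist : g.val + 2 ≤ h₂.val ∨ h₂.val + 2 ≤ g.val) (u : Fin n → Bool) :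
    Odd (fourCount c S g.val h₂.val u g) ↔
      (S.y g u ≠ S.y g (cornerFlip n h₂.val u) ∧
        decide ((c + g.val + walkExp u g.val) % 3 ≠ 0)
          ≠ decide ((c + g.val + walkExp (cornerFlip n g.val u) g.val) % 3 ≠ 0)) := by
  have hgval : g.val ≠ h₂.val := by intro e; rcases hdist with h | h <;> omega
  have hsg : S.s g ≠ g.val := by rw [hsplit]; exact hgval.symm
  unfold fourCount status
  rw [y_cornerFlip_of_ne S g _ u hsg, y_cornerFlip_of_ne S g _ _ hsg, live_cornerFlip_of_ne c g _ u hgval,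
    cornerFlip_comm hdist u, live_cornerFlip_of_ne c g _ _ hgval]
  have e := odd_fourStatus_iff (S.y g u) (S.y g (cornerFlip n h₂.val u))
    (decide ((c + g.val + walkExp u g.val) % 3 ≠ 0)) (decide ((c + g.val + walkExp (cornerFlip n g.val u) g.val) % 3 ≠ 0))
  refine Iff.trans ?_ e
  constructor <;> intro h <;> obtain ⟨k, hk⟩ := h <;> exact ⟨k, by omega⟩

/-- Step 4: the cut at the split has a four-count of product form when it co-observes `g`, and an even one otherwise. -/
theorem odd_fourCount_mirror_iff (c : ℕ) (S : TwoStep p n) (g h₂ : Fin (n + 1))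
    (hdist : g.val + 2 ≤ h₂.val ∨ h₂.val + 2 ≤ g.val) (u : Fin n → Bool) :
    Odd (fourCount c S g.val h₂.val u h₂) ↔
      (S.s h₂ = g.val ∧ S.y h₂ u ≠ S.y h₂ (cornerFlip n g.val u) ∧
        decide ((c + h₂.val + walkExp u h₂.val) % 3 ≠ 0)
          ≠ decide ((c + h₂.val + walkExp (cornerFlip n h₂.val u) h₂.val) % 3 ≠ 0)) := by
  have hgval : g.val ≠ h₂.val := by intro e; rcases hdist with h | h <;> omega
  by_cases hs : S.s h₂ = g.val
  · have hs2 : S.s h₂ ≠ h₂.val := by rw [hs]; exact hgval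
    unfold fourCount status
    rw [cornerFlip_comm hdist u, y_cornerFlip_of_ne S h₂ _ u hs2, y_cornerFlip_of_ne S h₂ _ _ hs2,
      live_cornerFlip_of_ne c h₂ _ u hgval.symm, ← cornerFlip_comm hdist u, live_cornerFlip_of_ne c h₂ _ _ hgval.symm]
    have e := odd_fourStatus_iff (S.y h₂ u) (S.y h₂ (cornerFlip n g.val u))
      (decide ((c + h₂.val + walkExp u h₂.val) % 3 ≠ 0))
      (decide ((c + h₂.val + walkExp (cornerFlip n h₂.val u) h₂.val) % 3 ≠ 0))
    simp only [hs, true_and]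
    refine Iff.trans ?_ e
    constructor <;> intro h <;> obtain ⟨k, hk⟩ := h <;> exact ⟨k, by omega⟩
  · have hg : h₂ ≠ g := fun e => hgval (by rw [e])
    have hev : Even (fourCount c S g.val h₂.val u h₂) := by
      unfold fourCount
      rw [status_cornerFlip_of_ne c S h₂ _ u hgval.symm hs, status_cornerFlip_of_ne c S h₂ _ _ hgval.symm hs]
      exact even_twoPairs (status c S h₂ u) (status c S h₂ (cornerFlip n h₂.val u))
    simp only [hs, false_and, iff_false]
    exact Nat.not_odd_iff_even.mpr hev

/-- **Four-point parity formula.**  `g` a cut with split `s_g = h₂.val` at distance `≥ 2` from its position, `h₂` the cut sitting at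
that split; `φ` / `ψ` the corner flips at `g` / at `s_g`.  Then
`disc u ⊕ disc (ψ u) = [y_g u ≠ y_g (ψu)]·[live_g u ≠ live_g (φu)] ⊕ [s_{h₂} = g]·[y_{h₂} u ≠ y_{h₂} (φu)]·[live_{h₂} u ≠ live_{h₂} (ψu)]`. -/
theorem fourPoint_formula (c : ℕ) (S : TwoStep p n) (g h₂ : Fin (n + 1)) (hsplit : S.s g = h₂.val)
    (hdist : g.val + 2 ≤ h₂.val ∨ h₂.val + 2 ≤ g.val) (u : Fin n → Bool) :
    (xor (discBit c S g.val u) (discBit c S g.val (cornerFlip n h₂.val u)) = true) ↔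
      ((S.y g u ≠ S.y g (cornerFlip n h₂.val u) ∧
          decide ((c + g.val + walkExp u g.val) % 3 ≠ 0)
            ≠ decide ((c + g.val + walkExp (cornerFlip n g.val u) g.val) % 3 ≠ 0)) ↔
        ¬ (S.s h₂ = g.val ∧ S.y h₂ u ≠ S.y h₂ (cornerFlip n g.val u) ∧
            decide ((c + h₂.val + walkExp u h₂.val) % 3 ≠ 0)
              ≠ decide ((c + h₂.val + walkExp (cornerFlip n h₂.val u) h₂.val) % 3 ≠ 0))) := by
  have hgh : g ≠ h₂ := by intro h; rw [h] at hdist; omega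
  rw [xor_discBit_iff_odd_sum,
    odd_sum_iff_of_even_off _ g h₂ hgh (fun h hg hh => even_fourCount_of_ne c S g h₂ hdist u h hg hh),
    Nat.odd_add, odd_fourCount_self_iff c S g h₂ hsplit hdist u, ← Nat.not_odd_iff_even,
    odd_fourCount_mirror_iff c S g h₂ hdist u]

/-- **Sufficient condition for `ψ`-discordance of the discordance bit** (the form used by the counting): if the flipped cut `g`
fires at `u` but not at `ψ u`, its liveness flips under `φ`, and the mirror term vanishes, then `disc u ≠ disc (ψ u)`. -/
theorem discBit_ne_of_main (c : ℕ) (S : TwoStep p n) (g h₂ : Fin (n + 1)) (hsplit : S.s g = h₂.val)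
    (hdist : g.val + 2 ≤ h₂.val ∨ h₂.val + 2 ≤ g.val) (u : Fin n → Bool)
    (hF : S.y g u ≠ S.y g (cornerFlip n h₂.val u))
    (hL : decide ((c + g.val + walkExp u g.val) % 3 ≠ 0) ≠ decide ((c + g.val + walkExp (cornerFlip n g.val u) g.val) % 3 ≠ 0))
    (hmirror : ¬ (S.s h₂ = g.val ∧ S.y h₂ u ≠ S.y h₂ (cornerFlip n g.val u) ∧
            decide ((c + h₂.val + walkExp u h₂.val) % 3 ≠ 0)
              ≠ decide ((c + h₂.val + walkExp (cornerFlip n h₂.val u) h₂.val) % 3 ≠ 0))) :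
    discBit c S g.val u ≠ discBit c S g.val (cornerFlip n h₂.val u) := by
  have h := (fourPoint_formula c S g h₂ hsplit hdist u).mpr ⟨fun _ => hmirror, fun _ => ⟨hF, hL⟩⟩
  intro heq
  rw [heq, Bool.xor_self] at h
  exact Bool.false_ne_true h

/-- **Second sufficient condition** (mirror active): if the flipped cut's term vanishes (it does not fire at `u` nor at `ψ u`) while the
mirror cut co-observes `g`, changes its fire bit under `φ` and its liveness under `ψ`, then `disc u ≠ disc (ψ u)`. -/
theorem discBit_ne_of_mirror (c : ℕ) (S : TwoStep p n) (g h₂ : Fin (n + 1)) (hsplit : S.s g = h₂.val)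
    (hdist : g.val + 2 ≤ h₂.val ∨ h₂.val + 2 ≤ g.val) (u : Fin n → Bool)
    (hF : S.y g u = S.y g (cornerFlip n h₂.val u))
    (hm1 : S.s h₂ = g.val) (hm2 : S.y h₂ u ≠ S.y h₂ (cornerFlip n g.val u))
    (hm3 : decide ((c + h₂.val + walkExp u h₂.val) % 3 ≠ 0)
              ≠ decide ((c + h₂.val + walkExp (cornerFlip n h₂.val u) h₂.val) % 3 ≠ 0)) :
    discBit c S g.val u ≠ discBit c S g.val (cornerFlip n h₂.val u) := by
  have h := (fourPoint_formula c S g h₂ hsplit hdist u).mpr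
    ⟨fun h' => (h'.1 hF).elim, fun h' => (h' ⟨hm1, hm2, hm3⟩).elim⟩
  intro heq
  rw [heq, Bool.xor_self] at h
  exact Bool.false_ne_true h

end FourPoint

end Summit.QuantumAdvantage.AdviceFreeQNC0.LocalEngine
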